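/-
Copyright (c) 2026 the pub-hodgecm-mathlib formalisation cell (harness21).  Prover seat hodgecm-mathlib-K2E5-p10 (g2),
Track B «K2-LIT» ∕ h413 (stmt-HodgeConjecture-24833), engine E5 «TamagawaUnitary», unit G organ (O6) FILE B′ (theorems):
THE BASE COMPARISON `ι|_{Nrd(D_{h,𝔸}^×)} = c(ι) • Ψ_h_* (m_∞|_{im_∞(h)} ⊗ m_f)` with `c(ι)` INDEPENDENT OF `h`.  2026-09-04.
-/
import Summits.HodgeConjecture.HodgeConjecture.Theorems.K2E5FixedIdeleBaseComparison          -- ★ (O6) FILE B (this seat, p856346); brings FILE A′∕A, ★ #3k, ★ `isOpen_quatNrdImage`, ★ `K2E5QuatNrdImageLattice`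
import Literature.NumberTheory.Automorphic.AdelicSecondCountable                            -- ★ `secondCountableTopology_finiteAdeleRing`
import Literature.NumberTheory.Automorphic.IdelicDyadicUnfolding                            -- ★ `locallyCompactSpace_ideleGroup`, `secondCountableTopology_ideleGroup`
import Literature.NumberTheory.NumberFields.FiniteIdeleHomIdealDescent                      -- ★ `IdeleIdeal.isCompact_ker_toIdealUnits`
import HarnessLib

/-!
# K2_E5 road (h413 = stmt-HodgeConjecture-24833), unit G organ (O6), FILE B′: the base comparison, `c(ι)` h-free

Cell `pub/hodgecm-mathlib` (D-0151), Track B; dealer K2E5-plan (g2), SWEEP #15 (O6); consumer letter K2E5-p17 (g2) 01:04:47Z: «→ K2E5-p10 (g2) FILE B: please state the measure identity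
over YOUR `quatNrdImageSplitEquiv` as `quatNrdImageMeasure L ι = c ι • Measure.map (quatNrdImageSplitEquiv L Ha hdet hHa) ((Measure.comap Subtype.val ι_∞⁰).prod ι_f⁰)` with `ι_∞⁰`
p04's h-free arch product measure and `ι_f⁰` a Haar measure on `↥(fixedFinAdelicUnits L)` … — I bridge the two image types in Layer 3».

THE HEAD (generic in the two h-FREE base measures — ANY Haar measure `mInf` on `W → ℝˣ`, e.g. p04's `Measure.pi (w ↦ unitsHaarOfAddHaar volume)`, and ANY Haar measure `mf` on
`↥(fixedFinAdelicUnits L)`, e.g. the one normalised on `𝒪̂^×_{L⁺}`):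

  **`quatNrdImageMeasure_eq_smul_map_prod`**: for `ι` a Haar measure on `𝕀_{L⁺} = fixedAdelicUnits L`,
  `quatNrdImageMeasure L ι = baseScalar L mInf mf ι • Measure.map (quatNrdImageSplitEquiv L h hdet hHa) ((mInf.comap Subtype.val : Measure ↥(archNrdImage L h hdet)).prod mf)`
  with **`baseScalar L mInf mf ι := haarScalarFactor ι (map (fixedIdeleSplitEquiv L) (mInf ⊗ mf))`** — a constant that does not mention `h` (`baseScalar_ne_zero`, `baseScalar_ne_top`).

Proof: `ι = c • Ψ_* (mInf ⊗ mf)` on `fixedAdelicUnits` (Haar uniqueness, Mathlib `isMulLeftInvariant_eq_smul`); restrict to the OPEN image torus (★ `isOpen_quatNrdImage`; `comap_smul`); the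
restriction of `Ψ_* (mInf ⊗ mf)` IS `(Ψ_h)_* (mInf|_{im_∞(h)} ⊗ mf)`: both are Haar measures on the image torus and they agree on the positive compact box `Ψ_h (B × 𝒪̂^×_{L⁺})`
(`comap`∕`map`∕`prod` evaluation; `↑(Ψ_h S) = Ψ ((val × id) S)` from ★ FILE A′), hence agree (Mathlib `haarMeasure_unique`).  The arch image must be OPEN — hypothesis `hA` = ★∕⏳ (O3b)
`K2E5QuatArchNrdOpen.isOpen_archNrdImage` (K2E5-p04 (g2), p856348).  σ-algebras: `[MeasurableSpace ℝˣ] [BorelSpace ℝˣ]` (`W → ℝˣ` gets `MeasurableSpace.pi`),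
`[MeasurableSpace ↥(fixedFinAdelicUnits L)] [BorelSpace …]`, `[MeasurableSpace (AdeleRing (𝓞 L) L)ˣ] [BorelSpace …]` (★ #3k's convention for `quatNrdImageMeasure`).

[cite: VignerasLNM800, Ch. III §2 (mesures sur K_A^× et n(H_A^×))] [cite: WeilBNT1967, Ch. IV §4; Ch. V §4] [cite: Folland1995, §2.2 (uniqueness of Haar measure)] [cite: BorelJacquet1979, §4.1]

HONEST LABEL: HC_CM is proved only modulo the 7 printed citations (2 remaining named inputs: hLiu418 = stmt-HodgeConjecture-24832,
h413 = stmt-HodgeConjecture-24833) until rung 0 closes; this file is a `--supports stmt-HodgeConjecture-24833 --as helper` leaf and retires nothing by itself.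
-/

set_option autoImplicit false
set_option linter.dupNamespace false   -- `Summit.HodgeConjecture.HodgeConjecture.…` (D-0017 nested layout; lakefile exemption for Summits)

noncomputable section

namespace Summit.HodgeConjecture.HodgeConjecture.Cruxes.H413.K2E5FixedIdeleBaseComparisonHead

open MeasureTheory Measure NumberField NumberField.InfinitePlace IsDedekindDomain Topology TopologicalSpace
open Literature.NumberTheory.Automorphic Literature.NumberTheory.Automorphic.UnitaryGroup
open Literature.NumberTheory.NumberFields
open Summit.HodgeConjecture.HodgeConjecture.Cruxes.H413.K2E5QuatAdelicNrd
open Summit.HodgeConjecture.HodgeConjecture.Cruxes.H413.K2E5QuatAdelicMeasure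
open Summit.HodgeConjecture.HodgeConjecture.Cruxes.H413.K2E5QuatFinNrd
open Summit.HodgeConjecture.HodgeConjecture.Cruxes.H413.K2E5QuatFinNrdLevelIndexFactorization (fixedFinIntUnits fixedFinIntUnits_le_fixedFinAdelicUnits)
open Summit.HodgeConjecture.HodgeConjecture.Cruxes.H413.K2E5QuatFinPinnedEqSmulProductOfPin (fixedFinIntUnits_eq_inf isOpen_ker_toIdealUnits)
open Summit.HodgeConjecture.HodgeConjecture.Cruxes.H413.K2E5QuatUnitsBetaExists (isOpen_quatNrdImage isHaarMeasure_quatNrdImageMeasure)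
open Summit.HodgeConjecture.HodgeConjecture.Cruxes.H413.K2E5QuatNrdImageLattice (locallyCompactSpace_quatNrdImage secondCountableTopology_quatNrdImage)
open Summit.HodgeConjecture.HodgeConjecture.Cruxes.H413.K2E5FixedIdeleBaseSplitting
open Summit.HodgeConjecture.HodgeConjecture.Cruxes.H413.K2E5QuatNrdImageSplitting
open Summit.HodgeConjecture.HodgeConjecture.Cruxes.H413.K2E5FixedIdeleBaseComparison
open scoped ENNReal NNReal Classical

variable (L : Type) [Field L] [NumberField L] [IsCMField L]

/-! ## §1 Topological side conditions on the base groups -/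

omit [IsCMField L] in
/-- `(𝔸_{L,f})^×` is second countable (★ `secondCountableTopology_finiteAdeleRing`, units embedding). [folklore] -/
theorem secondCountableTopology_units_finiteAdeleRing : SecondCountableTopology (FiniteAdeleRing (𝓞 L) L)ˣ := by
  haveI := secondCountableTopology_finiteAdeleRing L
  haveI : SecondCountableTopology (FiniteAdeleRing (𝓞 L) L)ᵐᵒᵖ := MulOpposite.opHomeomorph.symm.secondCountableTopology
  exact Units.isEmbedding_embedProduct.secondCountableTopology

/-- `(𝔸_{L⁺,f})^×` is second countable. [folklore] -/
theorem secondCountableTopology_fixedFinAdelicUnits : SecondCountableTopology ↥(fixedFinAdelicUnits L) := by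
  haveI := secondCountableTopology_units_finiteAdeleRing L
  exact TopologicalSpace.Subtype.secondCountableTopology _

/-- `𝒪̂^×_{L⁺}` is COMPACT and OPEN in `(𝔸_{L⁺,f})^×` (★ `IdeleIdeal.isCompact_ker_toIdealUnits`, ★ `isOpen_ker_toIdealUnits`, ★ `fixedFinIntUnits_eq_inf`, closed embedding ★ `isClosed_fixedFinAdelicUnits`).
[cite: WeilBNT1967, Ch. IV §4] [cite: CasselsFrohlichANT1967, Ch. II §16] -/
theorem isCompact_isOpen_finLevel₀ :
    IsCompact (((fixedFinIntUnits L).subgroupOf (fixedFinAdelicUnits L) : Subgroup ↥(fixedFinAdelicUnits L)) : Set ↥(fixedFinAdelicUnits L)) ∧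
      IsOpen (((fixedFinIntUnits L).subgroupOf (fixedFinAdelicUnits L) : Subgroup ↥(fixedFinAdelicUnits L)) : Set ↥(fixedFinAdelicUnits L)) := by
  have hset : (((fixedFinIntUnits L).subgroupOf (fixedFinAdelicUnits L) : Subgroup ↥(fixedFinAdelicUnits L)) : Set ↥(fixedFinAdelicUnits L)) =
      Subtype.val ⁻¹' (((IdeleIdeal.toIdealUnits (𝓞 L) L).ker : Subgroup (FiniteAdeleRing (𝓞 L) L)ˣ) : Set (FiniteAdeleRing (𝓞 L) L)ˣ) := by
    ext x
    simp only [SetLike.mem_coe, Subgroup.mem_subgroupOf, Set.mem_preimage]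
    rw [fixedFinIntUnits_eq_inf, Subgroup.mem_inf]
    exact ⟨fun h => h.2, fun h => ⟨x.2, h⟩⟩
  refine ⟨?_, ?_⟩
  · have hc : IsCompact (fixedFinIntUnits L : Set (FiniteAdeleRing (𝓞 L) L)ˣ) := by
      rw [fixedFinIntUnits_eq_inf, Subgroup.coe_inf]
      exact (IdeleIdeal.isCompact_ker_toIdealUnits (L := L)).inter_left (isClosed_fixedFinAdelicUnits L)
    have h2 : (((fixedFinIntUnits L).subgroupOf (fixedFinAdelicUnits L) : Subgroup ↥(fixedFinAdelicUnits L)) : Set ↥(fixedFinAdelicUnits L)) =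
        Subtype.val ⁻¹' (fixedFinIntUnits L : Set (FiniteAdeleRing (𝓞 L) L)ˣ) := by
      ext x; simp only [SetLike.mem_coe, Subgroup.mem_subgroupOf, Set.mem_preimage]
    rw [h2]
    exact (isClosed_fixedFinAdelicUnits L).isClosedEmbedding_subtypeVal.isCompact_preimage hc
  · rw [hset]
    exact (isOpen_ker_toIdealUnits L).preimage continuous_subtype_val

/-- `𝒪̂^×_{L⁺}` as a positive compact of `(𝔸_{L⁺,f})^×`. [cite: WeilBNT1967, Ch. IV §4] -/
def finLevel₀ : PositiveCompacts ↥(fixedFinAdelicUnits L) where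
  carrier := (((fixedFinIntUnits L).subgroupOf (fixedFinAdelicUnits L) : Subgroup ↥(fixedFinAdelicUnits L)) : Set ↥(fixedFinAdelicUnits L))
  isCompact' := (isCompact_isOpen_finLevel₀ L).1
  interior_nonempty' := by
    rw [(isCompact_isOpen_finLevel₀ L).2.interior_eq]
    exact ⟨1, Subgroup.one_mem _⟩

/-- `(𝔸_{L⁺,f})^×` is locally compact (compact open subgroup `𝒪̂^×_{L⁺}`). [cite: WeilBNT1967, Ch. IV §4] -/
theorem locallyCompactSpace_fixedFinAdelicUnits : LocallyCompactSpace ↥(fixedFinAdelicUnits L) :=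
  (finLevel₀ L).locallyCompactSpace_of_group

/-- `𝕀_{L⁺} = fixedAdelicUnits L` is locally compact (closed in the idèles). [cite: PlatonovRapinchuk1994, §5.1] -/
theorem locallyCompactSpace_fixedAdelicUnits : LocallyCompactSpace ↥(fixedAdelicUnits L) := by
  haveI : LocallyCompactSpace (AdeleRing (𝓞 L) L)ˣ := locallyCompactSpace_ideleGroup L
  exact (isClosed_fixedAdelicUnits L).locallyCompactSpace

/-- `fixedAdelicUnits L` is second countable. [folklore] -/
theorem secondCountableTopology_fixedAdelicUnits : SecondCountableTopology ↥(fixedAdelicUnits L) := by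
  haveI : SecondCountableTopology (AdeleRing (𝓞 L) L)ˣ := secondCountableTopology_ideleGroup L
  exact TopologicalSpace.Subtype.secondCountableTopology _

/-! ## §2 The h-free scalar `c(ι)` -/

section Scalar

variable [MeasurableSpace ℝˣ] [BorelSpace ℝˣ] [MeasurableSpace ↥(fixedFinAdelicUnits L)] [BorelSpace ↥(fixedFinAdelicUnits L)]
  [MeasurableSpace (AdeleRing (𝓞 L) L)ˣ] [BorelSpace (AdeleRing (𝓞 L) L)ˣ]

/-- The h-FREE reference Haar measure on the base `𝕀_{L⁺}`: `Ψ_* (mInf ⊗ mf)` along ★ FILE A `fixedIdeleSplitEquiv`. [cite: WeilBNT1967, Ch. IV §4] -/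
def baseMeasure (mInf : Measure ({w : InfinitePlace L // IsComplex w} → ℝˣ)) (mf : Measure ↥(fixedFinAdelicUnits L)) : Measure ↥(fixedAdelicUnits L) :=
  Measure.map (fixedIdeleSplitEquiv L) (mInf.prod mf)

/-- `Ψ_* (mInf ⊗ mf)` is a Haar measure on `𝕀_{L⁺}`. [cite: WeilBNT1967, Ch. IV §4] -/
theorem isHaarMeasure_baseMeasure (mInf : Measure ({w : InfinitePlace L // IsComplex w} → ℝˣ)) [mInf.IsHaarMeasure]
    (mf : Measure ↥(fixedFinAdelicUnits L)) [mf.IsHaarMeasure] : (baseMeasure L mInf mf).IsHaarMeasure := by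
  haveI := secondCountableTopology_units_real
  haveI := borelSpace_pi_units L
  haveI := secondCountableTopology_fixedFinAdelicUnits L
  haveI := locallyCompactSpace_fixedFinAdelicUnits L
  haveI : (mInf.prod mf).IsHaarMeasure := prod.instIsHaarMeasure mInf mf
  rw [baseMeasure]
  exact ContinuousMulEquiv.isHaarMeasure_map (mInf.prod mf) (fixedIdeleSplitEquiv L)

/-- **`c(ι) := haarScalarFactor ι (Ψ_* (mInf ⊗ mf))`** — the comparison constant; it mentions NO hermitian form. [cite: Folland1995, §2.2] -/
def baseScalar (mInf : Measure ({w : InfinitePlace L // IsComplex w} → ℝˣ)) [mInf.IsHaarMeasure] (mf : Measure ↥(fixedFinAdelicUnits L)) [mf.IsHaarMeasure]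
    (ι : Measure ↥(fixedAdelicUnits L)) [ι.IsHaarMeasure] : ℝ≥0 :=
  haveI := isHaarMeasure_baseMeasure L mInf mf
  haarScalarFactor ι (baseMeasure L mInf mf)

/-- **`ι = c(ι) • Ψ_* (mInf ⊗ mf)`** for every Haar measure `ι` on `𝕀_{L⁺}` (Haar uniqueness, Mathlib `isMulLeftInvariant_eq_smul`). [cite: Folland1995, §2.2 Thm. 2.20] -/
theorem eq_baseScalar_smul_baseMeasure (mInf : Measure ({w : InfinitePlace L // IsComplex w} → ℝˣ)) [mInf.IsHaarMeasure]
    (mf : Measure ↥(fixedFinAdelicUnits L)) [mf.IsHaarMeasure] (ι : Measure ↥(fixedAdelicUnits L)) [ι.IsHaarMeasure] :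
    ι = (baseScalar L mInf mf ι : ℝ≥0∞) • baseMeasure L mInf mf := by
  haveI := isHaarMeasure_baseMeasure L mInf mf
  haveI := locallyCompactSpace_fixedAdelicUnits L
  haveI := secondCountableTopology_fixedAdelicUnits L
  have h := isMulLeftInvariant_eq_smul ι (baseMeasure L mInf mf)
  rw [ENNReal.smul_def] at h
  unfold baseScalar
  exact h

/-- `c(ι) ≠ 0`. [cite: Folland1995, §2.2] -/
theorem baseScalar_ne_zero (mInf : Measure ({w : InfinitePlace L // IsComplex w} → ℝˣ)) [mInf.IsHaarMeasure]
    (mf : Measure ↥(fixedFinAdelicUnits L)) [mf.IsHaarMeasure] (ι : Measure ↥(fixedAdelicUnits L)) [ι.IsHaarMeasure] :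
    (baseScalar L mInf mf ι : ℝ≥0∞) ≠ 0 := by
  haveI := isHaarMeasure_baseMeasure L mInf mf
  exact ENNReal.coe_ne_zero.2 (by unfold baseScalar; exact (haarScalarFactor_pos_of_isHaarMeasure ι (baseMeasure L mInf mf)).ne')

/-- `c(ι) ≠ ⊤` (it is an `ℝ≥0`). [folklore] -/
theorem baseScalar_ne_top (mInf : Measure ({w : InfinitePlace L // IsComplex w} → ℝˣ)) [mInf.IsHaarMeasure] (mf : Measure ↥(fixedFinAdelicUnits L)) [mf.IsHaarMeasure]
    (ι : Measure ↥(fixedAdelicUnits L)) [ι.IsHaarMeasure] : (baseScalar L mInf mf ι : ℝ≥0∞) ≠ ⊤ :=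
  ENNReal.coe_ne_top

end Scalar

/-! ## §3 The restriction of `Ψ_* (mInf ⊗ mf)` to the image torus is `(Ψ_h)_* (mInf|_{im_∞(h)} ⊗ mf)` -/

section Restrict

variable (Ha : Matrix (Fin 2) (Fin 2) L) (hHa : (Ha.map (cmConjRingHom L)).transpose = Ha) (hdet : Ha.det ≠ 0)

/-- `↑(Ψ_h '' S) = Ψ '' ((val × id) '' S)` inside `fixedAdelicUnits` (★ FILE A′ `coe_quatNrdImageSplitEquiv_apply`). [folklore] -/
theorem image_val_quatNrdImageSplitEquiv (S : Set (↥(archNrdImage L Ha hdet) × ↥(fixedFinAdelicUnits L))) :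
    Subtype.val '' (quatNrdImageSplitEquiv L Ha hdet hHa '' S) =
      fixedIdeleSplitEquiv L '' (Prod.map (Subtype.val : ↥(archNrdImage L Ha hdet) → ({w : InfinitePlace L // IsComplex w} → ℝˣ)) id '' S) := by
  rw [Set.image_image, Set.image_image]
  rfl

/-- Preimage form: `Ψ⁻¹ (↑(Ψ_h '' (B ×ˢ K))) = (↑B) ×ˢ K`. [folklore] -/
theorem preimage_val_image_box (B : Set ↥(archNrdImage L Ha hdet)) (K : Set ↥(fixedFinAdelicUnits L)) :
    (fixedIdeleSplitEquiv L) ⁻¹' (Subtype.val '' (quatNrdImageSplitEquiv L Ha hdet hHa '' (B ×ˢ K))) = (Subtype.val '' B) ×ˢ K := by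
  rw [image_val_quatNrdImageSplitEquiv, (fixedIdeleSplitEquiv L).injective.preimage_image, Set.prodMap_image_prod, Set.image_id]

variable [MeasurableSpace ℝˣ] [BorelSpace ℝˣ] [MeasurableSpace ↥(fixedFinAdelicUnits L)] [BorelSpace ↥(fixedFinAdelicUnits L)]
  [MeasurableSpace (AdeleRing (𝓞 L) L)ˣ] [BorelSpace (AdeleRing (𝓞 L) L)ˣ]

include hHa hdet in
/-- **The restriction of the reference measure to the image torus is the transported product of the restricted arch measure and `mf`** (two Haar measures on
`Nrd((D_h ⊗ 𝔸)^×)` agreeing on the positive compact box `Ψ_h (B × 𝒪̂^×_{L⁺})`). [cite: Folland1995, §2.2] [cite: WeilBNT1967, Ch. IV §4] -/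
theorem comap_baseMeasure_eq_map_prod (mInf : Measure ({w : InfinitePlace L // IsComplex w} → ℝˣ)) [mInf.IsHaarMeasure]
    (mf : Measure ↥(fixedFinAdelicUnits L)) [mf.IsHaarMeasure] (hA : IsOpen (archNrdImage L Ha hdet : Set ({w : InfinitePlace L // IsComplex w} → ℝˣ))) :
    (baseMeasure L mInf mf).comap (Subtype.val : ↥(quatNrdImage L Ha) → ↥(fixedAdelicUnits L)) =
      Measure.map (quatNrdImageSplitEquiv L Ha hdet hHa)
        ((mInf.comap (Subtype.val : ↥(archNrdImage L Ha hdet) → ({w : InfinitePlace L // IsComplex w} → ℝˣ))).prod mf) := by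
  -- instances
  haveI := secondCountableTopology_units_real
  haveI := borelSpace_pi_units L
  haveI := secondCountableTopology_fixedFinAdelicUnits L
  haveI := locallyCompactSpace_fixedFinAdelicUnits L
  haveI := locallyCompactSpace_fixedAdelicUnits L
  haveI := secondCountableTopology_fixedAdelicUnits L
  haveI := locallyCompactSpace_quatNrdImage L Ha hHa hdet
  haveI := secondCountableTopology_quatNrdImage L Ha
  haveI := isHaarMeasure_baseMeasure L mInf mf
  haveI : LocallyCompactSpace ↥(archNrdImage L Ha hdet) := hA.locallyCompactSpace
  haveI hAinf : (mInf.comap (Subtype.val : ↥(archNrdImage L Ha hdet) → ({w : InfinitePlace L // IsComplex w} → ℝˣ))).IsHaarMeasure :=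
    IsHaarMeasure.comap (mH := inferInstance) mInf (f := (archNrdImage L Ha hdet).subtype) hA.isOpenEmbedding_subtypeVal
  haveI : ((mInf.comap (Subtype.val : ↥(archNrdImage L Ha hdet) → ({w : InfinitePlace L // IsComplex w} → ℝˣ))).prod mf).IsHaarMeasure :=
    prod.instIsHaarMeasure _ _
  haveI hR : (Measure.map (quatNrdImageSplitEquiv L Ha hdet hHa)
      ((mInf.comap (Subtype.val : ↥(archNrdImage L Ha hdet) → ({w : InfinitePlace L // IsComplex w} → ℝˣ))).prod mf)).IsHaarMeasure :=
    ContinuousMulEquiv.isHaarMeasure_map _ _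
  haveI hLH : ((baseMeasure L mInf mf).comap (Subtype.val : ↥(quatNrdImage L Ha) → ↥(fixedAdelicUnits L))).IsHaarMeasure :=
    IsHaarMeasure.comap (mH := inferInstance) (baseMeasure L mInf mf) (f := (quatNrdImage L Ha).subtype) (isOpen_quatNrdImage L Ha hHa hdet).isOpenEmbedding_subtypeVal
  -- a positive compact `B` inside the open arch image, and the box
  obtain ⟨B⟩ : Nonempty (PositiveCompacts ↥(archNrdImage L Ha hdet)) := PositiveCompacts.nonempty'
  set K₀ : PositiveCompacts ↥(quatNrdImage L Ha) :=
    PositiveCompacts.map (quatNrdImageSplitEquiv L Ha hdet hHa) (quatNrdImageSplitEquiv L Ha hdet hHa).continuous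
      (quatNrdImageSplitEquiv L Ha hdet hHa).toHomeomorph.isOpenMap (B ×ˢ finLevel₀ L) with hK₀
  have hK₀coe : (K₀ : Set ↥(quatNrdImage L Ha)) = quatNrdImageSplitEquiv L Ha hdet hHa '' ((B : Set ↥(archNrdImage L Ha hdet)) ×ˢ (finLevel₀ L : Set ↥(fixedFinAdelicUnits L))) := by
    rw [hK₀]; rfl
  -- both sides give the box the mass `mInf (↑B) * mf (𝒪̂^×)`
  have hval : MeasurableEmbedding (Subtype.val : ↥(quatNrdImage L Ha) → ↥(fixedAdelicUnits L)) :=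
    MeasurableEmbedding.subtype_coe (isOpen_quatNrdImage L Ha hHa hdet).measurableSet
  have hvalA : MeasurableEmbedding (Subtype.val : ↥(archNrdImage L Ha hdet) → ({w : InfinitePlace L // IsComplex w} → ℝˣ)) :=
    MeasurableEmbedding.subtype_coe hA.measurableSet
  have hmapΨ : ∀ s : Set ↥(fixedAdelicUnits L), (Measure.map (fixedIdeleSplitEquiv L) (mInf.prod mf)) s = (mInf.prod mf) ((fixedIdeleSplitEquiv L) ⁻¹' s) :=
    fun s => (fixedIdeleSplitEquiv L).toHomeomorph.toMeasurableEquiv.map_apply s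
  have hmapΨh : ∀ s : Set ↥(quatNrdImage L Ha),
      (Measure.map (quatNrdImageSplitEquiv L Ha hdet hHa) ((mInf.comap (Subtype.val : ↥(archNrdImage L Ha hdet) → ({w : InfinitePlace L // IsComplex w} → ℝˣ))).prod mf)) s =
        ((mInf.comap (Subtype.val : ↥(archNrdImage L Ha hdet) → ({w : InfinitePlace L // IsComplex w} → ℝˣ))).prod mf) ((quatNrdImageSplitEquiv L Ha hdet hHa) ⁻¹' s) :=
    fun s => (quatNrdImageSplitEquiv L Ha hdet hHa).toHomeomorph.toMeasurableEquiv.map_apply s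
  have h1 : ((baseMeasure L mInf mf).comap (Subtype.val : ↥(quatNrdImage L Ha) → ↥(fixedAdelicUnits L))) K₀ =
      mInf (Subtype.val '' (B : Set ↥(archNrdImage L Ha hdet))) * mf (finLevel₀ L : Set ↥(fixedFinAdelicUnits L)) := by
    rw [hval.comap_apply, hK₀coe, baseMeasure, hmapΨ, preimage_val_image_box, Measure.prod_prod]
  have h2 : (Measure.map (quatNrdImageSplitEquiv L Ha hdet hHa)
      ((mInf.comap (Subtype.val : ↥(archNrdImage L Ha hdet) → ({w : InfinitePlace L // IsComplex w} → ℝˣ))).prod mf)) K₀ =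
      mInf (Subtype.val '' (B : Set ↥(archNrdImage L Ha hdet))) * mf (finLevel₀ L : Set ↥(fixedFinAdelicUnits L)) := by
    rw [hK₀coe, hmapΨh, (quatNrdImageSplitEquiv L Ha hdet hHa).injective.preimage_image, Measure.prod_prod, hvalA.comap_apply]
  rw [haarMeasure_unique ((baseMeasure L mInf mf).comap (Subtype.val : ↥(quatNrdImage L Ha) → ↥(fixedAdelicUnits L))) K₀,
    haarMeasure_unique (Measure.map (quatNrdImageSplitEquiv L Ha hdet hHa)
      ((mInf.comap (Subtype.val : ↥(archNrdImage L Ha hdet) → ({w : InfinitePlace L // IsComplex w} → ℝˣ))).prod mf)) K₀, h1, h2]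

/-! ## §4 THE HEAD -/

include hHa hdet in
/-- **(O6) HEAD — `ι|_{Nrd((D_h ⊗ 𝔸)^×)} = c(ι) • (Ψ_h)_* (mInf|_{im_∞(h)} ⊗ mf)` with `c(ι) = baseScalar L mInf mf ι` INDEPENDENT OF `h`.**  For a CM field `L`, ANY Haar measures `mInf` on
`W → ℝˣ` and `mf` on `(𝔸_{L⁺,f})^×` (the two h-free reference measures), every Haar measure `ι` on `𝕀_{L⁺}`, and every anisotropic∕non-degenerate hermitian plane `h` whose arch image
`im_∞(h)` is open (★∕⏳ (O3b) `isOpen_archNrdImage`): ★ #3k's `quatNrdImageMeasure L ι` (= `ι` restricted to the open image torus) is `c(ι)` times the push-forward along ★ FILE A′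
`quatNrdImageSplitEquiv` of `(mInf|_{im_∞(h)}) ⊗ mf`.  With p04's `mInf := Measure.pi (w ↦ unitsHaarOfAddHaar volume)` and the normalised `mf` this is K2E5-p17 (g2)'s Layer-3 letter.
[cite: VignerasLNM800, Ch. III §2] [cite: WeilBNT1967, Ch. IV §4; Ch. V §4] [cite: Folland1995, §2.2 Thm. 2.20] -/
theorem quatNrdImageMeasure_eq_smul_map_prod (mInf : Measure ({w : InfinitePlace L // IsComplex w} → ℝˣ)) [mInf.IsHaarMeasure]
    (mf : Measure ↥(fixedFinAdelicUnits L)) [mf.IsHaarMeasure] (hA : IsOpen (archNrdImage L Ha hdet : Set ({w : InfinitePlace L // IsComplex w} → ℝˣ)))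
    (ι : Measure ↥(fixedAdelicUnits L)) [ι.IsHaarMeasure] :
    quatNrdImageMeasure L ι =
      (baseScalar L mInf mf ι : ℝ≥0∞) • Measure.map (quatNrdImageSplitEquiv L Ha hdet hHa)
        ((mInf.comap (Subtype.val : ↥(archNrdImage L Ha hdet) → ({w : InfinitePlace L // IsComplex w} → ℝˣ))).prod mf) := by
  rw [← comap_baseMeasure_eq_map_prod L Ha hHa hdet mInf mf hA, ← Measure.comap_smul, ← eq_baseScalar_smul_baseMeasure L mInf mf ι]
  rfl

include hHa hdet in
/-- The head in the `∃ c ≠ 0, ⊤` letter shape of the consumer (`c` chosen BEFORE `h`). [cite: VignerasLNM800, Ch. III §2] [cite: Folland1995, §2.2] -/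
theorem exists_baseScalar_quatNrdImageMeasure_eq (mInf : Measure ({w : InfinitePlace L // IsComplex w} → ℝˣ)) [mInf.IsHaarMeasure]
    (mf : Measure ↥(fixedFinAdelicUnits L)) [mf.IsHaarMeasure] (ι : Measure ↥(fixedAdelicUnits L)) [ι.IsHaarMeasure] :
    ∃ c : ℝ≥0∞, c ≠ 0 ∧ c ≠ ⊤ ∧ c = (baseScalar L mInf mf ι : ℝ≥0∞) ∧
      (IsOpen (archNrdImage L Ha hdet : Set ({w : InfinitePlace L // IsComplex w} → ℝˣ)) →
        quatNrdImageMeasure L ι = c • Measure.map (quatNrdImageSplitEquiv L Ha hdet hHa)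
          ((mInf.comap (Subtype.val : ↥(archNrdImage L Ha hdet) → ({w : InfinitePlace L // IsComplex w} → ℝˣ))).prod mf)) :=
  ⟨_, baseScalar_ne_zero L mInf mf ι, baseScalar_ne_top L mInf mf ι, rfl, fun hA => quatNrdImageMeasure_eq_smul_map_prod L Ha hHa hdet mInf mf hA ι⟩

end Restrict

end Summit.HodgeConjecture.HodgeConjecture.Cruxes.H413.K2E5FixedIdeleBaseComparisonHead

end
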